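import Literature.NumberTheory.EllipticCurves.IwasawaAlgebraPseudoNullPrimePairProofs
import Literature.RingTheory.PowerSeries.WeierstrassEvaluationAtMaximal
import HarnessLib

/-!
# The «height-two pair» `(w·(T − b), d₂)` with `d₂(b) ≠ 0` over a complete local domain `A`: modules killed by both are PSEUDO-NULL, and
# `(w(T − b), d₂)·M′ ⊆ M ⟹ char(N/M) = char(N/(M′ + M))` — de Shalit II §4.12 (29)–(32) / III Lemma 1.10 in the Coleman lane's two-variable frame

Generic commutative algebra (everything PROVED, nothing assumed): the instantiation of `IwasawaAlgebraPseudoNullPrimePairProofs`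
(`f` prime, `f ∤ g` ⟹ pseudo-null) at the pair met by the cell's Coleman lane — `f = T − C b` is PRIME in `A⟦T⟧` for `b ∈ 𝔪_A`, `A` a complete local
domain (the tree's `Literature.RingTheory.PowerSeries.prime_X_sub_C`), and `f ∣ d₂ ↔ d₂(b) = 0` (`X_sub_C_dvd_iff_maxEval_eq_zero`, Weierstrass evaluation
`maxEval` at a point of `𝔪`).  So, EXACTLY in the hypothesis shape of the lane's division step `Literature.RingTheory.PowerSeries.exists_eq_mul_of_mul_eq_mul`
(`d₁ = w·(T − b)`, `w` a unit, `maxEval hb d₂ ≠ 0`):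

* ★ `Module.isPseudoNull_of_isTorsionBy_X_sub_C_of_maxEval_ne_zero` — `(T − b)·M = 0`, `d₂·M = 0`, `d₂(b) ≠ 0` ⟹ `M` pseudo-null;
* ★ `Module.isPseudoNull_of_isTorsionBy_unit_mul_X_sub_C` — the same with `d₁ = w·(T − b)`;
* ★★ `Module.charIdeal_quotient_eq_of_linear_pair_smul_le` — `d₁·M′ ⊆ M`, `d₂·M′ ⊆ M` ⟹ **`char(N/M) = char(N/(M′ ⊔ M))`** (`N/M` finitely generated torsion).

USE (cell `bsd-print-cf2`, width seat `bsd-line-cf2c-w7` g24, brick §4(c), item D4 case (β) of `Cruxes/TwoVariableMainConjAtSplitTwoQuad/BRICK-C-ITEMS-g24.md`):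
in the (c)-capstone's frame (`A = 𝒪_v⟦X⟧`, `t_{𝔞₁} − N𝔞₁ = w·(T − b)` after g18's rescaling, `maxEval hb (t_{𝔞₂} − N𝔞₂) ≠ 0` = g18's
`maxEval_twistFactor_ne_zero_*`), Kato's relation (`EllipticUnitsLocalRelation.artin_mul_pow_eq`) gives `(t_{𝔞ᵢ} − N𝔞ᵢ)·⟨units of non-liftable twist⟩ ⊆
⟨lane units⟩`, so the non-liftable twists do not change the characteristic ideal.  `--supports` crux stmt-BirchSwinnertonDyer-24033.  BSD is not advanced
by this file.

References: E. de Shalit, *Iwasawa theory of elliptic curves with complex multiplication* (1987), II §4.12 (29)–(32), III Lemma 1.10; L. C. Washington,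
*Introduction to Cyclotomic Fields* (1997), §7.1 Prop. 7.2; N. Bourbaki, *Algèbre commutative* VII §4.5.
-/

noncomputable section

namespace Literature.NumberTheory.EllipticCurves

namespace Module

open _root_.PowerSeries Literature.RingTheory.PowerSeries

variable {A : Type*} [CommRing A] [IsLocalRing A] [IsDomain A] [IsNoetherianRing A] [IsAdicComplete (IsLocalRing.maximalIdeal A) A]
  {b : A} (hb : b ∈ IsLocalRing.maximalIdeal A)
  {M : Type*} [AddCommGroup M] [_root_.Module (PowerSeries A) M]
  {N : Type*} [AddCommGroup N] [_root_.Module (PowerSeries A) N]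

omit [IsNoetherianRing A] in
include hb in
/-- ★ **`(T − b)·M = 0`, `d₂·M = 0`, `d₂(b) ≠ 0` ⟹ `M` pseudo-null** (`T − b` is prime and does not divide `d₂`).
[cite: deShalit1987, III Lemma 1.10 (p. 95), II §4.12 (29)–(32)] [cite: Washington1997, §7.1 Prop. 7.2] -/
theorem isPseudoNull_of_isTorsionBy_X_sub_C_of_maxEval_ne_zero {d₂ : PowerSeries A} (hd₂ : maxEval hb d₂ ≠ 0)
    (hMf : Module.IsTorsionBy (PowerSeries A) M (X - C b)) (hMg : Module.IsTorsionBy (PowerSeries A) M d₂) :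
    IsPseudoNull (PowerSeries A) M :=
  isPseudoNull_of_isTorsionBy_prime_of_not_dvd (prime_X_sub_C hb) (fun h ↦ hd₂ ((X_sub_C_dvd_iff_maxEval_eq_zero hb d₂).mp h)) hMf hMg

omit [IsNoetherianRing A] in
include hb in
/-- ★ **The same for `d₁ = w·(T − b)` with `w` a unit** (the shape in which the lane meets it: `(T − b)·m = w⁻¹·(d₁·m) = 0`).
[cite: deShalit1987, II §4.12 (29)–(32)] -/
theorem isPseudoNull_of_isTorsionBy_unit_mul_X_sub_C {d₁ d₂ w : PowerSeries A} (hw : IsUnit w) (hd₁ : d₁ = w * (X - C b))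
    (hd₂ : maxEval hb d₂ ≠ 0) (hMf : Module.IsTorsionBy (PowerSeries A) M d₁) (hMg : Module.IsTorsionBy (PowerSeries A) M d₂) :
    IsPseudoNull (PowerSeries A) M := by
  refine isPseudoNull_of_isTorsionBy_X_sub_C_of_maxEval_ne_zero hb hd₂ (fun m ↦ ?_) hMg
  have e : (X - C b : PowerSeries A) = ↑hw.unit⁻¹ * d₁ := by
    rw [hd₁, ← mul_assoc, IsUnit.val_inv_mul, one_mul]
  show (X - C b) • m = 0
  rw [e, mul_smul, @hMf m, smul_zero]

include hb in
/-- ★★ **`char(N ⧸ M) = char(N ⧸ (M′ ⊔ M))` when `d₁·M′ ⊆ M` and `d₂·M′ ⊆ M`** for `d₁ = w·(T − b)` (`w` a unit, `b ∈ 𝔪_A`) and `d₂(b) ≠ 0`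
(`N ⧸ M` finitely generated torsion). [cite: deShalit1987, III §1.4 (5), Lemma 1.10] [cite: BourbakiAC5to7, Ch. VII §4 no. 5] -/
theorem charIdeal_quotient_eq_of_linear_pair_smul_le (M' M₀ : Submodule (PowerSeries A) N) [Module.Finite (PowerSeries A) (N ⧸ M₀)]
    (hM₀ : Module.IsTorsion (PowerSeries A) (N ⧸ M₀)) {d₁ d₂ w : PowerSeries A} (hw : IsUnit w) (hd₁ : d₁ = w * (X - C b))
    (hd₂ : maxEval hb d₂ ≠ 0) (h₁ : ∀ a ∈ M', d₁ • a ∈ M₀) (h₂ : ∀ a ∈ M', d₂ • a ∈ M₀) :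
    charIdeal (PowerSeries A) (N ⧸ M₀) = charIdeal (PowerSeries A) (N ⧸ (M' ⊔ M₀)) := by
  refine charIdeal_quotient_eq_of_prime_pair_smul_le M' M₀ hM₀ (prime_X_sub_C hb)
    (fun h ↦ hd₂ ((X_sub_C_dvd_iff_maxEval_eq_zero hb d₂).mp h)) (fun a ha ↦ ?_) h₂
  -- `(T − b)·a = w⁻¹·(d₁·a) ∈ M₀`
  have e : (X - C b : PowerSeries A) = ↑hw.unit⁻¹ * d₁ := by
    rw [hd₁, ← mul_assoc, IsUnit.val_inv_mul, one_mul]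
  rw [e, mul_smul]
  exact M₀.smul_mem _ (h₁ a ha)

end Module

end Literature.NumberTheory.EllipticCurves
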